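import Mathlib.Geometry.Manifold.Complex
import Mathlib.Data.Finset.NatAntidiagonal
import Mathlib.LinearAlgebra.Dimension.Finrank
import Mathlib.Analysis.Convex.Basic
import Literature.NumberTheory.Transcendental.ComplexForms
import HarnessLib

-- provenance: harness21/H21/H21/Prelude/TranscendKaehlerL/Dolbeault.lean @ 2642559 (interim HEAD d8f2665); M5 mechanical rewrite
/-!
# The Dolbeault complex: `∂̄`, `∂`, Dolbeault cohomology and Hodge numbers

Trunk **T-KAEHLER** (G26 `TranscendKaehlerL`, item C10 `Dolbeault`; notion
`dolbeault_cohomology`).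

Let `M` be a complex manifold modelled on the complex normed space `E` (we work with the real
model `𝓘(ℝ, E)`, complex-valued `k`-forms being `Literature.MForm 𝓘(ℝ, E) M ℂ k`, cf.
`Literature.Prelude.TranscendKaehlerL.ComplexForms`). This file sets up

* the operators `∂̄ = Literature.dolbeaultBar` and `∂ = Literature.dolbeault`: for a `k`-form `α` with type
  decomposition `α = ∑_{p+q=k} α^{p,q}`, `∂̄α = ∑_{p+q=k} (dα^{p,q})^{p,q+1}` and
  `∂α = ∑_{p+q=k} (dα^{p,q})^{p+1,q}`; on a complex manifold `d = ∂ + ∂̄`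
  (`Literature.NumberTheory.Transcendental.mextDeriv_eq_dolbeault_add_dolbeaultBar`, integrability of the complex structure);
* the Dolbeault complex `(A^{p,•}(M), ∂̄)`: `Literature.dolbeaultClosedForms E M p q = ker ∂̄ ∩ A^{p,q}`,
  `Literature.dolbeaultExactForms E M p q = ∂̄(A^{p,q-1})`, the **Dolbeault cohomology**
  `Literature.dolbeaultCohomology E M p q = H^{p,q}_{∂̄}(M)` with its class map
  `Literature.NumberTheory.Transcendental.dolbeaultCohomology.mk`, and the **Hodge numbers**
  `Literature.hodgeNumber E M p q = dim_ℂ H^{p,q}_{∂̄}(M)`;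
* holomorphic `p`-forms `Literature.holomorphicForms E M p = H^{p,0}_{∂̄}(M) = Ω^p(M)` and the predicate
  `Literature.NumberTheory.Transcendental.IsHolomorphicForm`;
* the standard API: `∂̄² = 0`, `∂² = 0`, `∂∂̄ + ∂̄∂ = 0`
  (`Literature.NumberTheory.Transcendental.dolbeault_dolbeaultBar_add_dolbeaultBar_dolbeault`), Leibniz, `∂̄ ᾱ = \overline{∂α}`,
  `∂̄` raises the type by `(0,1)`, holomorphy of functions as `∂̄f = 0`, the `∂̄`-Poincaré
  (Dolbeault–Grothendieck) lemma, Cartan–Serre finiteness on compact `M`, and `h^{0,0} = 1`.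

Mathlib has no differential forms on manifolds and no Dolbeault theory at this pin (searched:
`Dolbeault`, `dolbeault`, `hodgeNumber`, `holomorphicForm` — nothing; only
`Mathlib.Analysis.Calculus.DifferentialForm.Basic` on normed spaces and `MDifferentiable` for
holomorphy). Anchors used: `Finset.antidiagonal`, `Submodule.span`, `Submodule.comap`,
`Submodule.mkQ`, `Module.finrank`, `MDifferentiable`, `ContMDiff`, `Convex`,
`TopologicalSpace.Opens` (with Mathlib's charted-space structure on open subsets).

Design notes.
* `∂̄` and `∂` are defined through G21's chart-wise `mextDeriv` and C9's type projections, so they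
  make sense (as junk) on every form; all differentiating statements assume smoothness and a
  **holomorphic atlas** `[IsManifold 𝓘(ℂ, E) ω M] [IsManifold 𝓘(ℝ, E) ∞ M]` (type projections of
  smooth forms are smooth only for `ℂ`-linear transition derivatives, review 11 of the outline).
  The named facts of `ComplexForms` used in proofs (`isSmoothForm_typeComponent`,
  `typeComponent_conj`, `mextDeriv_conj`) and of this file (`dolbeaultBar_smul`,
  `IsOfType.dolbeaultBar_eq`, `IsOfType.dolbeaultBar`, `dolbeaultBar_dolbeaultBar`) are threaded
  as explicit hypotheses (`hst`, `htc`, `hdc`, `hsm`, `hdeq`, `hty`, `hdd`, and `hsd` for G21's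
  `isSmoothForm_mextDeriv`). The named facts of the section `Holomorphic` carry the atlas
  instances as explicit binders (a `def … : Prop` does not pick up unused section instances).
  **Downstream note (M5 migration):** the signatures of `dolbeaultBar_add`, `dolbeault_add`,
  `isSmoothForm_dolbeaultBar`, `isSmoothForm_dolbeault`, `dolbeaultBar_conj`, `dolbeault_conj`,
  `mem_dolbeaultClosedForms_of_isOfType_of_isClosedForm`, `mem_dolbeaultClosedForms_iff`,
  `mem_holomorphicForms_iff`, `isSmoothForm_of_mem_dolbeaultClosedForms`,
  `dolbeaultExactForms_le_dolbeaultClosedForms` gained these hypotheses; the importers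
  `KaehlerHodge` (already migrated, references only in preserved-proof comments),
  `HodgeDecomposition` and `DeRhamComparison` (docstring references only) have no live-code use,
  so nothing breaks; future users thread the facts explicitly.
* The submodules are `Submodule.span`s of the natural carriers (as in C9); the spans add nothing
  (`Literature.NumberTheory.Transcendental.mem_dolbeaultClosedForms_iff`). `dolbeaultExactForms E M p` is defined by pattern
  matching on `q` (`⊥` for `q = 0`), avoiding `q - 1`.
* `hodgeNumber` is `Module.finrank`, hence carries the **junk value `0`** when `H^{p,q}_{∂̄}(M)` is
  infinite-dimensional (e.g. for non-compact `M`), exactly like G04's `Literature.AlgebraicTopology.SingularHomology.bettiNumber`; every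
  theorem about it carries `[CompactSpace M]`.

References: C. Voisin, *Hodge Theory and Complex Algebraic Geometry I* (2002), §2.3.3,
Prop. 2.31, Prop. 2.36, §2.4; P. Griffiths, J. Harris, *Principles of Algebraic Geometry* (1978),
pp. 23–25, 45; D. Huybrechts, *Complex Geometry* (2005), §1.3, §2.6; H. Cartan, J.-P. Serre,
*Un théorème de finitude concernant les variétés analytiques compactes*, C. R. Acad. Sci. 237
(1953).
-/

noncomputable section

open scoped Manifold ContDiff Topology
open Bundle Set Finset

namespace Literature.NumberTheory.Transcendental

variable {E : Type*} [NormedAddCommGroup E] [NormedSpace ℂ E]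
  {M : Type*} [TopologicalSpace M] [ChartedSpace E M] {k l : ℕ}

/-! ### The operators `∂̄` and `∂` -/

/-- The **Dolbeault operator** `∂̄` on complex `k`-forms:
`∂̄α = ∑_{p+q=k} (d(α^{p,q}))^{p,q+1}`, the `(0,1)`-part of the exterior derivative applied
type by type. Voisin (2002), §2.3.3 (Def. before Prop. 2.31); Griffiths–Harris (1978), p. 24;
Huybrechts (2005), Def. 1.3.5 / §2.6. [cite: Voisin2002] -/
def dolbeaultBar (α : Literature.Geometry.Kaehler.MForm 𝓘(ℝ, E) M ℂ k) : Literature.Geometry.Kaehler.MForm 𝓘(ℝ, E) M ℂ (k + 1) :=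
  ∑ pq ∈ antidiagonal k, (Literature.Geometry.Kaehler.mextDeriv (α.typeComponent pq.1 pq.2)).typeComponent pq.1 (pq.2 + 1)

/-- The operator `∂` on complex `k`-forms: `∂α = ∑_{p+q=k} (d(α^{p,q}))^{p+1,q}`, the
`(1,0)`-part of the exterior derivative applied type by type. Voisin (2002), §2.3.3;
Griffiths–Harris (1978), p. 24; Huybrechts (2005), §2.6. [cite: Voisin2002] -/
def dolbeault (α : Literature.Geometry.Kaehler.MForm 𝓘(ℝ, E) M ℂ k) : Literature.Geometry.Kaehler.MForm 𝓘(ℝ, E) M ℂ (k + 1) :=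
  ∑ pq ∈ antidiagonal k, (Literature.Geometry.Kaehler.mextDeriv (α.typeComponent pq.1 pq.2)).typeComponent (pq.1 + 1) pq.2

/-- `∂̄ 0 = 0`. [folklore] -/
@[simp]
theorem dolbeaultBar_zero : dolbeaultBar (0 : Literature.Geometry.Kaehler.MForm 𝓘(ℝ, E) M ℂ k) = 0 := by
  simp [dolbeaultBar, Literature.Geometry.Kaehler.mextDeriv_zero]

/-- `∂ 0 = 0`. [folklore] -/
@[simp]
theorem dolbeault_zero : dolbeault (0 : Literature.Geometry.Kaehler.MForm 𝓘(ℝ, E) M ℂ k) = 0 := by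
  simp [dolbeault, Literature.Geometry.Kaehler.mextDeriv_zero]

/-- `∂̄` commutes with complex scalars (no smoothness needed, cf. `mextDeriv_smul_complex`).
Voisin (2002), §2.3.3. [cite: Voisin2002] -/
def dolbeaultBar_smul : Prop :=
  ∀ (c : ℂ) (α : Literature.Geometry.Kaehler.MForm 𝓘(ℝ, E) M ℂ k),
    dolbeaultBar (c • α) = c • dolbeaultBar α

/- interim proof relied on results that are now named facts (D-0014); demoted to a fact by the M5 import, proof preserved:
:= by
  simp only [dolbeaultBar, Finset.smul_sum, MForm.typeComponent_smul, mextDeriv_smul_complex]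
-/

/-- `∂` commutes with complex scalars (no smoothness needed). Voisin (2002), §2.3.3. [cite: Voisin2002] -/
def dolbeault_smul : Prop :=
  ∀ (c : ℂ) (α : Literature.Geometry.Kaehler.MForm 𝓘(ℝ, E) M ℂ k),
    dolbeault (c • α) = c • dolbeault α

/- interim proof relied on results that are now named facts (D-0014); demoted to a fact by the M5 import, proof preserved:
:= by
  simp only [dolbeault, Finset.smul_sum, MForm.typeComponent_smul, mextDeriv_smul_complex]
-/

/-- For a form of pure type `(p,q)`, `∂̄α = (dα)^{p,q+1}` (only one summand survives).
Voisin (2002), §2.3.3; Griffiths–Harris (1978), p. 24. [cite: Voisin2002] -/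
def IsOfType.dolbeaultBar_eq : Prop :=
  ∀ {p q : ℕ} {α : Literature.Geometry.Kaehler.MForm 𝓘(ℝ, E) M ℂ k} (hα : IsOfType p q α),
    dolbeaultBar α = (Literature.Geometry.Kaehler.mextDeriv α).typeComponent p (q + 1)

/- interim proof relied on results that are now named facts (D-0014); demoted to a fact by the M5 import, proof preserved:
:= by
  have hmem : (p, q) ∈ antidiagonal k := by simpa using hα.1
  rw [dolbeaultBar, ← Finset.sum_erase_add _ _ hmem,
    (isOfType_iff_typeComponent_eq_self hα.1 α).mp hα, Finset.sum_eq_zero, zero_add]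
  rintro ⟨p', q'⟩ hpq
  have hne : p ≠ p' ∨ q ≠ q' := by
    by_contra h
    push Not at h
    exact (Finset.mem_erase.mp hpq).1 (by rw [h.1, h.2])
  simp [hα.typeComponent_of_ne hne, mextDeriv_zero]
-/

/-- For a form of pure type `(p,q)`, `∂α = (dα)^{p+1,q}` (only one summand survives).
Voisin (2002), §2.3.3; Griffiths–Harris (1978), p. 24. [cite: Voisin2002] -/
def IsOfType.dolbeault_eq : Prop :=
  ∀ {p q : ℕ} {α : Literature.Geometry.Kaehler.MForm 𝓘(ℝ, E) M ℂ k} (hα : IsOfType p q α),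
    dolbeault α = (Literature.Geometry.Kaehler.mextDeriv α).typeComponent (p + 1) q

/- interim proof relied on results that are now named facts (D-0014); demoted to a fact by the M5 import, proof preserved:
:= by
  have hmem : (p, q) ∈ antidiagonal k := by simpa using hα.1
  rw [dolbeault, ← Finset.sum_erase_add _ _ hmem,
    (isOfType_iff_typeComponent_eq_self hα.1 α).mp hα, Finset.sum_eq_zero, zero_add]
  rintro ⟨p', q'⟩ hpq
  have hne : p ≠ p' ∨ q ≠ q' := by
    by_contra h
    push Not at h
    exact (Finset.mem_erase.mp hpq).1 (by rw [h.1, h.2])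
  simp [hα.typeComponent_of_ne hne, mextDeriv_zero]
-/

/-- **`∂̄` raises the type by `(0,1)`**: if `α` has type `(p,q)` then `∂̄α` has type `(p,q+1)`.
Voisin (2002), §2.3.3; Huybrechts (2005), Lemma 1.3.6. [cite: Voisin2002] -/
def IsOfType.dolbeaultBar : Prop :=
  ∀ {p q : ℕ} {α : Literature.Geometry.Kaehler.MForm 𝓘(ℝ, E) M ℂ k} (hα : IsOfType p q α),
    IsOfType p (q + 1) (Literature.NumberTheory.Transcendental.dolbeaultBar α)

/- interim proof relied on results that are now named facts (D-0014); demoted to a fact by the M5 import, proof preserved: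
:= by
  rw [hα.dolbeaultBar_eq]
  exact isOfType_typeComponent (by have := hα.1; omega) _
-/

/-- **`∂` raises the type by `(1,0)`**: if `α` has type `(p,q)` then `∂α` has type `(p+1,q)`.
Voisin (2002), §2.3.3; Huybrechts (2005), Lemma 1.3.6. [cite: Voisin2002] -/
def IsOfType.dolbeault : Prop :=
  ∀ {p q : ℕ} {α : Literature.Geometry.Kaehler.MForm 𝓘(ℝ, E) M ℂ k} (hα : IsOfType p q α),
    IsOfType (p + 1) q (Literature.NumberTheory.Transcendental.dolbeault α)

/- interim proof relied on results that are now named facts (D-0014); demoted to a fact by the M5 import, proof preserved: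
:= by
  rw [hα.dolbeault_eq]
  exact isOfType_typeComponent (by have := hα.1; omega) _
-/

/-! ### The Dolbeault complex and Dolbeault cohomology -/

variable (E M) in
/-- The `ℂ`-module `Z^{p,q}_{∂̄}(M)` of **`∂̄`-closed smooth `(p,q)`-forms** (the `ℂ`-span of the
carrier `{α smooth, of type (p,q), ∂̄α = 0}`; on a complex manifold the span adds nothing,
`mem_dolbeaultClosedForms_iff`). Voisin (2002), §2.3.3; Griffiths–Harris (1978), p. 25. [cite: Voisin2002] -/
def dolbeaultClosedForms (p q : ℕ) : Submodule ℂ (Literature.Geometry.Kaehler.MForm 𝓘(ℝ, E) M ℂ (p + q)) :=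
  Submodule.span ℂ {α | Literature.Geometry.Kaehler.IsSmoothForm α ∧ IsOfType p q α ∧ dolbeaultBar α = 0}

variable (E M) in
/-- The `ℂ`-module `B^{p,q}_{∂̄}(M) = ∂̄(A^{p,q-1}(M))` of **`∂̄`-exact smooth `(p,q)`-forms**:
`⊥` for `q = 0` and the `ℂ`-span of `∂̄(A^{p,q}(M))` in bidegree `(p,q+1)` (pattern matching
avoids `q - 1`). Voisin (2002), §2.3.3; Griffiths–Harris (1978), p. 25. [cite: Voisin2002] -/
def dolbeaultExactForms (p : ℕ) : (q : ℕ) → Submodule ℂ (Literature.Geometry.Kaehler.MForm 𝓘(ℝ, E) M ℂ (p + q))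
  | 0 => ⊥
  | q + 1 => Submodule.span ℂ
      (dolbeaultBar '' (pqForms E M p q : Set (Literature.Geometry.Kaehler.MForm 𝓘(ℝ, E) M ℂ (p + q))))

variable (E M) in
/-- **Dolbeault cohomology** `H^{p,q}_{∂̄}(M) = Z^{p,q}_{∂̄}(M) / B^{p,q}_{∂̄}(M)` (the exact forms
pulled back into the closed ones, so no inclusion proof enters the definition).
Voisin (2002), §2.3.3; Griffiths–Harris (1978), p. 25; Huybrechts (2005), Def. 2.6.20. [cite: Voisin2002] -/
def dolbeaultCohomology (p q : ℕ) : Type _ :=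
  ↥(dolbeaultClosedForms E M p q) ⧸
    (dolbeaultExactForms E M p q).comap (dolbeaultClosedForms E M p q).subtype

namespace dolbeaultCohomology

variable {p q : ℕ}

/-- The additive group structure on Dolbeault cohomology (the quotient structure, given
explicitly because instance search through the type synonym is slow). [folklore] -/
instance instAddCommGroup : AddCommGroup (dolbeaultCohomology E M p q) :=
  Submodule.Quotient.addCommGroup _

/-- The `ℂ`-module structure on Dolbeault cohomology (the quotient structure). [folklore] -/
instance instModule : Module ℂ (dolbeaultCohomology E M p q) :=
  Submodule.Quotient.module _

variable (E M p q) in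
/-- The Dolbeault class `[α] ∈ H^{p,q}_{∂̄}(M)` of a `∂̄`-closed smooth `(p,q)`-form
(Voisin (2002), §2.3.3; Griffiths–Harris (1978), p. 25). [cite: Voisin2002] -/
def mk : dolbeaultClosedForms E M p q →ₗ[ℂ] dolbeaultCohomology E M p q :=
  Submodule.mkQ _

/-- Every Dolbeault class is represented by a `∂̄`-closed smooth `(p,q)`-form. [folklore] -/
theorem mk_surjective : Function.Surjective (mk E M p q) :=
  Submodule.mkQ_surjective _

/-- Two `∂̄`-closed forms define the same Dolbeault class iff their difference is `∂̄`-exact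
(Griffiths–Harris (1978), p. 25). [cite: GriffithsHarris1978] -/
theorem mk_eq_mk_iff (α β : dolbeaultClosedForms E M p q) :
    mk E M p q α = mk E M p q β ↔
      (α : Literature.Geometry.Kaehler.MForm 𝓘(ℝ, E) M ℂ (p + q)) - β ∈ dolbeaultExactForms E M p q :=
  (Submodule.Quotient.eq _).trans Iff.rfl

end dolbeaultCohomology

variable (E M) in
/-- The **Hodge number** `h^{p,q}(M) = dim_ℂ H^{p,q}_{∂̄}(M)`, defined as `Module.finrank`.
**Junk value:** `Module.finrank` is `0` whenever the module is not finite-dimensional, so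
`hodgeNumber E M p q = 0` carries no information when `H^{p,q}_{∂̄}(M)` is infinite-dimensional
(e.g. for many non-compact `M`); the definition is meaningful for compact complex manifolds,
where `finite_dolbeaultCohomology` (Cartan–Serre) applies, and every theorem about it assumes
`[CompactSpace M]` (compare G04's `Literature.AlgebraicTopology.SingularHomology.bettiNumber`). Not to be confused with the abstract
`Literature.AlgebraicGeometry.Motives.HodgeStructure.hodgeNumber` (T-MOTIVE-ABSTRACT) and `Literature.AlgebraicGeometry.Motives.DeRhamRealization.hodgeNumber`
(T-MOTIVE-L), which live in their own namespaces and take a Hodge structure, resp. a de Rham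
realization, as argument. Voisin (2002), §6.1; Griffiths–Harris (1978), p. 25;
Huybrechts (2005), Def. 2.6.20. [cite: Voisin2002] -/
def hodgeNumber (p q : ℕ) : ℕ :=
  Module.finrank ℂ (dolbeaultCohomology E M p q)

variable (E M) in
/-- The `ℂ`-module `Ω^p(M) = H^{p,0}_{∂̄}(M)` of **holomorphic `p`-forms**: smooth `(p,0)`-forms
with `∂̄α = 0` (there are no `∂̄`-exact `(p,0)`-forms). Voisin (2002), §2.3.3;
Griffiths–Harris (1978), p. 25; Huybrechts (2005), §2.6. [cite: Voisin2002] -/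
def holomorphicForms (p : ℕ) : Submodule ℂ (Literature.Geometry.Kaehler.MForm 𝓘(ℝ, E) M ℂ p) :=
  dolbeaultClosedForms E M p 0

/-- A complex `p`-form is **holomorphic** if it is smooth, of type `(p,0)` and `∂̄`-closed.
Voisin (2002), §2.3.3; Griffiths–Harris (1978), p. 25; Huybrechts (2005), §2.6. [cite: Voisin2002] -/
def IsHolomorphicForm {p : ℕ} (α : Literature.Geometry.Kaehler.MForm 𝓘(ℝ, E) M ℂ p) : Prop :=
  Literature.Geometry.Kaehler.IsSmoothForm α ∧ IsOfType p 0 α ∧ dolbeaultBar α = 0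

/-- Holomorphic forms lie in `holomorphicForms` (the generators of the span). [folklore] -/
theorem IsHolomorphicForm.mem_holomorphicForms {p : ℕ} {α : Literature.Geometry.Kaehler.MForm 𝓘(ℝ, E) M ℂ p}
    (hα : IsHolomorphicForm α) : α ∈ holomorphicForms E M p :=
  Submodule.subset_span hα

/-- `∂̄`-closed smooth `(p,q)`-forms lie in `dolbeaultClosedForms` (the generators of the span). [folklore] -/
theorem mem_dolbeaultClosedForms {p q : ℕ} {α : Literature.Geometry.Kaehler.MForm 𝓘(ℝ, E) M ℂ (p + q)}
    (hα : Literature.Geometry.Kaehler.IsSmoothForm α) (ht : IsOfType p q α) (hd : dolbeaultBar α = 0) :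
    α ∈ dolbeaultClosedForms E M p q :=
  Submodule.subset_span ⟨hα, ht, hd⟩

/-- In bidegree `(p,0)` there are no `∂̄`-exact forms (by definition). [folklore] -/
@[simp]
theorem dolbeaultExactForms_zero (p : ℕ) : dolbeaultExactForms E M p 0 = ⊥ :=
  rfl

/-- `∂̄` of a smooth `(p,q)`-form is `∂̄`-exact in bidegree `(p,q+1)` (a generator of the span). [folklore] -/
theorem dolbeaultBar_mem_dolbeaultExactForms {p q : ℕ} {α : Literature.Geometry.Kaehler.MForm 𝓘(ℝ, E) M ℂ (p + q)}
    (hα : α ∈ pqForms E M p q) : dolbeaultBar α ∈ dolbeaultExactForms E M p (q + 1) :=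
  Submodule.subset_span ⟨α, hα, rfl⟩

/-! ### Statements needing a holomorphic atlas -/

section Holomorphic

/-! In this section the holomorphic-atlas instances `[IsManifold 𝓘(ℂ, E) ω M]`
`[IsManifold 𝓘(ℝ, E) ∞ M]` are written as explicit binders on each named fact (a
`def … : Prop` does not pick up unused section instances), and theorems take the facts they use
as hypotheses. -/

/-- `∂̄` is additive on smooth forms, given smoothness of type components (the named fact
`isSmoothForm_typeComponent`, hypothesis `hst`) (Voisin (2002), §2.3.3). [cite: Voisin2002] -/
theorem dolbeaultBar_add (hst : ∀ {k : ℕ}, isSmoothForm_typeComponent (E := E) (M := M) (k := k))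
    {α β : Literature.Geometry.Kaehler.MForm 𝓘(ℝ, E) M ℂ k} (hα : Literature.Geometry.Kaehler.IsSmoothForm α) (hβ : Literature.Geometry.Kaehler.IsSmoothForm β) :
    dolbeaultBar (α + β) = dolbeaultBar α + dolbeaultBar β := by
  rw [dolbeaultBar, dolbeaultBar, dolbeaultBar, ← Finset.sum_add_distrib]
  refine Finset.sum_congr rfl fun pq _ ↦ ?_
  rw [Literature.Geometry.Kaehler.MForm.typeComponent_add, Literature.Geometry.Kaehler.mextDeriv_add (hst _ _ hα) (hst _ _ hβ), Literature.Geometry.Kaehler.MForm.typeComponent_add]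

/-- `∂` is additive on smooth forms, given `isSmoothForm_typeComponent` (`hst`)
(Voisin (2002), §2.3.3). [cite: Voisin2002] -/
theorem dolbeault_add (hst : ∀ {k : ℕ}, isSmoothForm_typeComponent (E := E) (M := M) (k := k))
    {α β : Literature.Geometry.Kaehler.MForm 𝓘(ℝ, E) M ℂ k} (hα : Literature.Geometry.Kaehler.IsSmoothForm α) (hβ : Literature.Geometry.Kaehler.IsSmoothForm β) :
    dolbeault (α + β) = dolbeault α + dolbeault β := by
  rw [dolbeault, dolbeault, dolbeault, ← Finset.sum_add_distrib]
  refine Finset.sum_congr rfl fun pq _ ↦ ?_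
  rw [Literature.Geometry.Kaehler.MForm.typeComponent_add, Literature.Geometry.Kaehler.mextDeriv_add (hst _ _ hα) (hst _ _ hβ), Literature.Geometry.Kaehler.MForm.typeComponent_add]

/-- `∂̄` of a smooth form is smooth, given `isSmoothForm_typeComponent` (`hst`) and smoothness
of `d` on smooth forms (`hsd`, G21's `isSmoothForm_mextDeriv`) (Voisin (2002), §2.3.3). [cite: Voisin2002] -/
theorem isSmoothForm_dolbeaultBar (hst : ∀ {k : ℕ}, isSmoothForm_typeComponent (E := E) (M := M) (k := k))
    (hsd : ∀ {k : ℕ} {β : Literature.Geometry.Kaehler.MForm 𝓘(ℝ, E) M ℂ k}, Literature.Geometry.Kaehler.IsSmoothForm β → Literature.Geometry.Kaehler.IsSmoothForm (Literature.Geometry.Kaehler.mextDeriv β))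
    {α : Literature.Geometry.Kaehler.MForm 𝓘(ℝ, E) M ℂ k} (hα : Literature.Geometry.Kaehler.IsSmoothForm α) : Literature.Geometry.Kaehler.IsSmoothForm (dolbeaultBar α) := by
  refine Finset.sum_induction _ Literature.Geometry.Kaehler.IsSmoothForm (fun _ _ ha hb ↦ ha.add hb) Literature.Geometry.Kaehler.isSmoothForm_zero
    fun pq _ ↦ ?_
  exact hst _ _ (hsd (hst _ _ hα))

/-- `∂` of a smooth form is smooth, given `isSmoothForm_typeComponent` (`hst`) and smoothness
of `d` on smooth forms (`hsd`) (Voisin (2002), §2.3.3). [cite: Voisin2002] -/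
theorem isSmoothForm_dolbeault (hst : ∀ {k : ℕ}, isSmoothForm_typeComponent (E := E) (M := M) (k := k))
    (hsd : ∀ {k : ℕ} {β : Literature.Geometry.Kaehler.MForm 𝓘(ℝ, E) M ℂ k}, Literature.Geometry.Kaehler.IsSmoothForm β → Literature.Geometry.Kaehler.IsSmoothForm (Literature.Geometry.Kaehler.mextDeriv β))
    {α : Literature.Geometry.Kaehler.MForm 𝓘(ℝ, E) M ℂ k} (hα : Literature.Geometry.Kaehler.IsSmoothForm α) : Literature.Geometry.Kaehler.IsSmoothForm (dolbeault α) := by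
  refine Finset.sum_induction _ Literature.Geometry.Kaehler.IsSmoothForm (fun _ _ ha hb ↦ ha.add hb) Literature.Geometry.Kaehler.isSmoothForm_zero
    fun pq _ ↦ ?_
  exact hst _ _ (hsd (hst _ _ hα))

/-- **`d = ∂ + ∂̄` on a complex manifold**: the exterior derivative of a smooth `(p,q)`-form has
only components of types `(p+1,q)` and `(p,q+1)`. This is the integrability of the complex
structure (automatic for a holomorphic atlas). Voisin (2002), Prop. 2.31 / §2.3.3;
Griffiths–Harris (1978), p. 24; Huybrechts (2005), Prop. 2.6.15. [cite: Voisin2002] -/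
def mextDeriv_eq_dolbeault_add_dolbeaultBar [IsManifold 𝓘(ℂ, E) ω M] [IsManifold 𝓘(ℝ, E) ∞ M] : Prop :=
  ∀ {α : Literature.Geometry.Kaehler.MForm 𝓘(ℝ, E) M ℂ k} (hα : Literature.Geometry.Kaehler.IsSmoothForm α),
    Literature.Geometry.Kaehler.mextDeriv α = dolbeault α + dolbeaultBar α

/-- **`∂̄² = 0`** on smooth forms (from `d² = 0` and `d = ∂ + ∂̄` by comparing types).
Voisin (2002), §2.3.3; Griffiths–Harris (1978), p. 25; Huybrechts (2005), Cor. 2.6.18. [cite: Voisin2002] -/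
def dolbeaultBar_dolbeaultBar [IsManifold 𝓘(ℂ, E) ω M] [IsManifold 𝓘(ℝ, E) ∞ M] : Prop :=
  ∀ {α : Literature.Geometry.Kaehler.MForm 𝓘(ℝ, E) M ℂ k} (hα : Literature.Geometry.Kaehler.IsSmoothForm α),
    dolbeaultBar (dolbeaultBar α) = 0

/-- **`∂² = 0`** on smooth forms. Voisin (2002), §2.3.3; Griffiths–Harris (1978), p. 25;
Huybrechts (2005), Cor. 2.6.18. [cite: Voisin2002] -/
def dolbeault_dolbeault [IsManifold 𝓘(ℂ, E) ω M] [IsManifold 𝓘(ℝ, E) ∞ M] : Prop :=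
  ∀ {α : Literature.Geometry.Kaehler.MForm 𝓘(ℝ, E) M ℂ k} (hα : Literature.Geometry.Kaehler.IsSmoothForm α),
    dolbeault (dolbeault α) = 0

/-- **`∂∂̄ + ∂̄∂ = 0`** on smooth forms (outline name `dolbeault_dolbeaultBar_add`, renamed after
its full statement). Voisin (2002), §2.3.3; Griffiths–Harris (1978), p. 25; Huybrechts (2005),
Cor. 2.6.18. [cite: Voisin2002] -/
def dolbeault_dolbeaultBar_add_dolbeaultBar_dolbeault [IsManifold 𝓘(ℂ, E) ω M] [IsManifold 𝓘(ℝ, E) ∞ M] : Prop :=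
  ∀ {α : Literature.Geometry.Kaehler.MForm 𝓘(ℝ, E) M ℂ k} (hα : Literature.Geometry.Kaehler.IsSmoothForm α),
    dolbeault (dolbeaultBar α) + dolbeaultBar (dolbeault α) = 0

/-- **Leibniz rule for `∂̄`**: `∂̄(α ∧ β) = ∂̄α ∧ β + (-1)^k α ∧ ∂̄β` for smooth forms (the first
summand cast from degree `(k + 1) + l` to `(k + l) + 1`). Voisin (2002), §2.3.3;
Griffiths–Harris (1978), p. 24; Huybrechts (2005), Lemma 1.3.6. [cite: Voisin2002] -/
def dolbeaultBar_wedge [IsManifold 𝓘(ℂ, E) ω M] [IsManifold 𝓘(ℝ, E) ∞ M] : Prop :=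
  ∀ {α : Literature.Geometry.Kaehler.MForm 𝓘(ℝ, E) M ℂ k} {β : Literature.Geometry.Kaehler.MForm 𝓘(ℝ, E) M ℂ l} (hα : Literature.Geometry.Kaehler.IsSmoothForm α) (hβ : Literature.Geometry.Kaehler.IsSmoothForm β),
    dolbeaultBar (α.wedge β) =
      ((dolbeaultBar α).wedge β).castDeg (Nat.add_right_comm k 1 l) +
        ((-1 : ℝ) ^ k) • α.wedge (dolbeaultBar β)

/-- **Leibniz rule for `∂`**: `∂(α ∧ β) = ∂α ∧ β + (-1)^k α ∧ ∂β` for smooth forms.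
Voisin (2002), §2.3.3; Griffiths–Harris (1978), p. 24. [cite: Voisin2002] -/
def dolbeault_wedge [IsManifold 𝓘(ℂ, E) ω M] [IsManifold 𝓘(ℝ, E) ∞ M] : Prop :=
  ∀ {α : Literature.Geometry.Kaehler.MForm 𝓘(ℝ, E) M ℂ k} {β : Literature.Geometry.Kaehler.MForm 𝓘(ℝ, E) M ℂ l} (hα : Literature.Geometry.Kaehler.IsSmoothForm α) (hβ : Literature.Geometry.Kaehler.IsSmoothForm β),
    dolbeault (α.wedge β) =
      ((dolbeault α).wedge β).castDeg (Nat.add_right_comm k 1 l) +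
        ((-1 : ℝ) ^ k) • α.wedge (dolbeault β)

/-- **`∂̄ ᾱ = \overline{∂α}`**: conjugation intertwines `∂̄` and `∂` (algebraic: from
the named facts `mextDeriv_conj` and `typeComponent_conj`, hypotheses `hdc`, `htc`; no atlas
hypothesis). Voisin (2002), §2.3.3; Griffiths–Harris (1978), p. 24. [cite: Voisin2002] -/
theorem dolbeaultBar_conj (htc : ∀ {k : ℕ}, typeComponent_conj (E := E) (M := M) (k := k))
    (hdc : mextDeriv_conj (E := E) (M := M) (k := k)) (α : Literature.Geometry.Kaehler.MForm 𝓘(ℝ, E) M ℂ k) :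
    dolbeaultBar α.conj = (dolbeault α).conj := by
  have h := map_sum (Literature.Geometry.Kaehler.MForm.conjₛₗ (E := E) (M := M) (k + 1))
    (fun pq : ℕ × ℕ ↦ (Literature.Geometry.Kaehler.mextDeriv (α.typeComponent pq.1 pq.2)).typeComponent (pq.1 + 1) pq.2)
    (antidiagonal k)
  simp only [Literature.Geometry.Kaehler.MForm.conjₛₗ_apply] at h
  rw [dolbeaultBar, dolbeault, h]
  conv_lhs => rw [← Finset.HasAntidiagonal.map_prodComm_antidiagonal, Finset.sum_map]
  refine Finset.sum_congr rfl fun pq _ ↦ ?_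
  simp only [Equiv.coe_toEmbedding, Equiv.prodComm_apply, Prod.fst_swap, Prod.snd_swap]
  rw [htc pq.2 pq.1, hdc, htc pq.2 (pq.1 + 1)]

/-- **`∂ ᾱ = \overline{∂̄α}`** (hypotheses `htc`, `hdc` as in `dolbeaultBar_conj`). Voisin (2002),
§2.3.3; Griffiths–Harris (1978), p. 24. [cite: Voisin2002] -/
theorem dolbeault_conj (htc : ∀ {k : ℕ}, typeComponent_conj (E := E) (M := M) (k := k))
    (hdc : mextDeriv_conj (E := E) (M := M) (k := k)) (α : Literature.Geometry.Kaehler.MForm 𝓘(ℝ, E) M ℂ k) :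
    dolbeault α.conj = (dolbeaultBar α).conj := by
  rw [← Literature.Geometry.Kaehler.MForm.conj_conj (dolbeault α.conj), ← dolbeaultBar_conj htc hdc, Literature.Geometry.Kaehler.MForm.conj_conj]

/-- A **closed** smooth form of pure type `(p,q)` is `∂̄`-closed
(`dα = 0 ⇒ ∂̄α = (dα)^{p,q+1} = 0`, algebraic, via the named fact `IsOfType.dolbeaultBar_eq`,
hypothesis `hdeq`), hence lies in `Z^{p,q}_{∂̄}(M)`. This is the map
from closed `(p,q)`-forms to Dolbeault cohomology used in the comparison `H^{p,q} ≅ H^{p,q}_{∂̄}`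
on compact Kähler manifolds. Voisin (2002), §6.1.1 (Lemma 6.6 set-up); Huybrechts (2005), §2.6. [cite: Voisin2002] -/
theorem mem_dolbeaultClosedForms_of_isOfType_of_isClosedForm {p q : ℕ}
    (hdeq : IsOfType.dolbeaultBar_eq (E := E) (M := M) (k := p + q))
    {α : Literature.Geometry.Kaehler.MForm 𝓘(ℝ, E) M ℂ (p + q)} (hα : Literature.Geometry.Kaehler.IsSmoothForm α) (ht : IsOfType p q α)
    (hc : Literature.Geometry.Kaehler.IsClosedForm α) : α ∈ dolbeaultClosedForms E M p q := by
  refine mem_dolbeaultClosedForms hα ht ?_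
  rw [hdeq ht, show Literature.Geometry.Kaehler.mextDeriv α = 0 from hc, Literature.Geometry.Kaehler.MForm.typeComponent_zero]

/-- Membership in `dolbeaultClosedForms` is "smooth, of type `(p,q)` and `∂̄`-closed" (the span
adds nothing, by additivity of `∂̄` on smooth forms; hypotheses: the named facts
`isSmoothForm_typeComponent` (`hst`) and `dolbeaultBar_smul` (`hsm`)). Voisin (2002), §2.3.3. [cite: Voisin2002] -/
theorem mem_dolbeaultClosedForms_iff (hst : ∀ {k : ℕ}, isSmoothForm_typeComponent (E := E) (M := M) (k := k)) {p q : ℕ}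
    (hsm : dolbeaultBar_smul (E := E) (M := M) (k := p + q)) (α : Literature.Geometry.Kaehler.MForm 𝓘(ℝ, E) M ℂ (p + q)) :
    α ∈ dolbeaultClosedForms E M p q ↔ Literature.Geometry.Kaehler.IsSmoothForm α ∧ IsOfType p q α ∧ dolbeaultBar α = 0 := by
  let S : Submodule ℂ (Literature.Geometry.Kaehler.MForm 𝓘(ℝ, E) M ℂ (p + q)) :=
    { carrier := {α | Literature.Geometry.Kaehler.IsSmoothForm α ∧ IsOfType p q α ∧ dolbeaultBar α = 0}
      add_mem' := fun hα hβ ↦ ⟨hα.1.add hβ.1, hα.2.1.add hβ.2.1, by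
        rw [dolbeaultBar_add hst hα.1 hβ.1, hα.2.2, hβ.2.2, add_zero]⟩
      zero_mem' := ⟨Literature.Geometry.Kaehler.isSmoothForm_zero, isOfType_zero rfl, dolbeaultBar_zero⟩
      smul_mem' := fun c _ hα ↦ ⟨hα.1.smul_complex c, hα.2.1.smul c, by
        rw [hsm, hα.2.2, smul_zero]⟩ }
  have h : dolbeaultClosedForms E M p q = S :=
    le_antisymm (Submodule.span_le.mpr fun α hα ↦ hα) fun α hα ↦ Submodule.subset_span hα
  rw [h]
  rfl

/-- Membership in `holomorphicForms` is `IsHolomorphicForm` (hypotheses `hst`, `hsm` as in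
`mem_dolbeaultClosedForms_iff`) (Voisin (2002), §2.3.3). [cite: Voisin2002] -/
theorem mem_holomorphicForms_iff (hst : ∀ {k : ℕ}, isSmoothForm_typeComponent (E := E) (M := M) (k := k)) {p : ℕ}
    (hsm : dolbeaultBar_smul (E := E) (M := M) (k := p + 0)) (α : Literature.Geometry.Kaehler.MForm 𝓘(ℝ, E) M ℂ p) :
    α ∈ holomorphicForms E M p ↔ IsHolomorphicForm α :=
  mem_dolbeaultClosedForms_iff hst (p := p) (q := 0) hsm α

/-- `∂̄`-closed forms are smooth (hypotheses `hst`, `hsm` as in `mem_dolbeaultClosedForms_iff`). [folklore] -/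
theorem isSmoothForm_of_mem_dolbeaultClosedForms (hst : ∀ {k : ℕ}, isSmoothForm_typeComponent (E := E) (M := M) (k := k)) {p q : ℕ}
    (hsm : dolbeaultBar_smul (E := E) (M := M) (k := p + q)) {α : Literature.Geometry.Kaehler.MForm 𝓘(ℝ, E) M ℂ (p + q)}
    (hα : α ∈ dolbeaultClosedForms E M p q) : Literature.Geometry.Kaehler.IsSmoothForm α :=
  ((mem_dolbeaultClosedForms_iff hst hsm α).mp hα).1

/-- **`∂̄`-exact forms are `∂̄`-closed**, `B^{p,q}_{∂̄} ⊆ Z^{p,q}_{∂̄}` (from `∂̄² = 0`, `∂̄`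
raising the type by `(0,1)` and smoothness of `∂̄α`; hypotheses: the named facts
`isSmoothForm_typeComponent` (`hst`), `IsOfType.dolbeaultBar` (`hty`),
`dolbeaultBar_dolbeaultBar` (`hdd`) and smoothness of `d` (`hsd`)). Voisin (2002), §2.3.3; Griffiths–Harris (1978),
p. 25. [cite: Voisin2002] -/
theorem dolbeaultExactForms_le_dolbeaultClosedForms [IsManifold 𝓘(ℂ, E) ω M] [IsManifold 𝓘(ℝ, E) ∞ M]
    (hst : ∀ {k : ℕ}, isSmoothForm_typeComponent (E := E) (M := M) (k := k))
    (hsd : ∀ {k : ℕ} {β : Literature.Geometry.Kaehler.MForm 𝓘(ℝ, E) M ℂ k}, Literature.Geometry.Kaehler.IsSmoothForm β → Literature.Geometry.Kaehler.IsSmoothForm (Literature.Geometry.Kaehler.mextDeriv β))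
    (hty : ∀ {k : ℕ}, IsOfType.dolbeaultBar (E := E) (M := M) (k := k))
    (hdd : ∀ {k : ℕ}, dolbeaultBar_dolbeaultBar (E := E) (M := M) (k := k)) {p q : ℕ} :
    dolbeaultExactForms E M p q ≤ dolbeaultClosedForms E M p q := by
  cases q with
  | zero => exact bot_le
  | succ q =>
    refine Submodule.span_le.mpr ?_
    rintro _ ⟨α, hα, rfl⟩
    obtain ⟨hs, ht⟩ := (mem_pqForms_iff α).mp hα
    exact mem_dolbeaultClosedForms (isSmoothForm_dolbeaultBar hst hsd hs) (hty ht) (hdd hs)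

/-- **Holomorphic functions are the `∂̄`-closed functions.** For a `C¹` function `f : M → ℂ`,
viewed as the complex `0`-form `x ↦ f x`, `∂̄f = 0` iff `f` is holomorphic
(`MDifferentiable` for the complex model `𝓘(ℂ, E)`), i.e. iff `df` is `ℂ`-linear
(Cauchy–Riemann). The `C¹` hypothesis is needed because `mextDeriv` (hence `∂̄`) takes junk
values on non-differentiable forms. Voisin (2002), §2.3.3 and Lemma 2.29;
Griffiths–Harris (1978), p. 2; Huybrechts (2005), §1.3. [cite: Voisin2002] -/
def dolbeaultBar_eq_zero_iff_mdifferentiable [IsManifold 𝓘(ℂ, E) ω M] [IsManifold 𝓘(ℝ, E) ∞ M] : Prop :=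
  ∀ {f : M → ℂ} (hf : ContMDiff 𝓘(ℝ, E) 𝓘(ℝ, ℂ) 1 f),
    dolbeaultBar (fun x ↦ ContinuousAlternatingMap.constOfIsEmpty ℝ (TangentSpace 𝓘(ℝ, E) x)
        (Fin 0) (f x) : Literature.Geometry.Kaehler.MForm 𝓘(ℝ, E) M ℂ 0) = 0 ↔
      MDifferentiable 𝓘(ℂ, E) 𝓘(ℂ, ℂ) f

omit [ChartedSpace E M] in
/-- **`∂̄`-Poincaré (Dolbeault–Grothendieck) lemma**: on a convex open subset `U` of a
finite-dimensional complex vector space, `H^{p,q}_{∂̄}(U) = 0` for `q ≥ 1` (every `∂̄`-closed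
smooth `(p,q+1)`-form is `∂̄`-exact; `q + 1` encodes `q ≥ 1`). Stated for convex `U` (in
particular polydiscs and `E` itself): L. Hörmander, *An Introduction to Complex Analysis in
Several Variables* (1990), Cor. 4.2.6 with Thm. 2.6.7/4.2.8 (convex ⇒ pseudoconvex ⇒
`H^{p,q}_{∂̄} = 0` for `q ≥ 1`); equivalently Cartan's Theorem B for the Stein domain `U`. The
polydisc case is Voisin (2002), Prop. 2.36; Griffiths–Harris (1978), p. 25 (`∂̄`-Poincaré
lemma); Huybrechts (2005), Cor. 1.3.9 / Prop. 2.6.21. [cite: Voisin2002] -/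
def subsingleton_dolbeaultCohomology_of_convex : Prop :=
  ∀ [FiniteDimensional ℂ E] (U : TopologicalSpace.Opens E) (hU : Convex ℝ (U : Set E)) (p q : ℕ),
    Subsingleton (dolbeaultCohomology E U p (q + 1))

/-- **Cartan–Serre finiteness**: on a compact (Hausdorff) complex manifold the Dolbeault
cohomology groups `H^{p,q}_{∂̄}(M)` are finite-dimensional. The `T2Space` hypothesis is
essential (gluing two copies of a compact Riemann surface along a disc gives a compact
non-Hausdorff `M` with infinite-dimensional `H^{0,1}_{∂̄}`). Cartan–Serre (1953); Voisin (2002),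
Cor. 5.25 (via Hodge theory for `∂̄`); Griffiths–Harris (1978), p. 84. [cite: CartanSerre1953] -/
def finite_dolbeaultCohomology [IsManifold 𝓘(ℂ, E) ω M] [IsManifold 𝓘(ℝ, E) ∞ M] : Prop :=
  ∀ [FiniteDimensional ℂ E] [T2Space M] [CompactSpace M] (p q : ℕ),
    Module.Finite ℂ (dolbeaultCohomology E M p q)

/-- **`h^{0,0} = 1`** for a compact connected complex manifold: `H^{0,0}_{∂̄}(M)` is the space of
global holomorphic functions (`dolbeaultBar_eq_zero_iff_mdifferentiable`), which are constant by
the maximum principle — Mathlib's `MDifferentiable.exists_eq_const_of_compactSpace`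
(`Mathlib.Geometry.Manifold.Complex`, needing only `CompactSpace` and `PreconnectedSpace`, no
Hausdorff hypothesis); `ConnectedSpace` supplies nonemptiness so that constants are nonzero.
Voisin (2002), §2.3.3; Griffiths–Harris (1978), p. 25; Huybrechts (2005), §2.6. [cite: Voisin2002] -/
def hodgeNumber_zero_zero [IsManifold 𝓘(ℂ, E) ω M] [IsManifold 𝓘(ℝ, E) ∞ M] : Prop :=
  ∀ [FiniteDimensional ℂ E] [CompactSpace M] [ConnectedSpace M],
    hodgeNumber E M 0 0 = 1

end Holomorphic

end Literature.NumberTheory.Transcendental
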